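import Summits.Ventures.PercRepro.RankLevelSetDelPays

/-!
# PercRepro — THE DELETION-PAYS DOOR AT A POINT OF A LINE: the exposure is bounded by a count of `M ＼ e` (night-1, gen 13)

At a girth point `e` of a simple matroid with a triangle `{e, x, y}` (`e ∈ cl{x, y}`), every `e`-free partition
`(A, B)` of `E ∖ e` (`e` in the closure of neither side, `Matroid.freeCount`) is `{x,y}`-FREE: the pair `{x, y}`
lies in the closure of neither side — because `{x,y} ⊆ cl(A)` would give `e ∈ cl{x,y} ⊆ cl(A)`.  The `{x,y}`-free
count `lineFreeCount M e x y a b` is a statement about the DELETION `N = M ＼ e` and the pair `{x, y}` alone (for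
`A ⊆ E ∖ e`, `x, y ∈ cl_M(A)` iff `x, y ∈ cl_N(A)`), so the DELETION-PAYS door of `RankLevelSetDelPays` becomes, at a
point of a line, an inequality purely in `N`: the principal extension of `N` on the line `xy` is the worst case
(its `e`-free partitions are exactly the `{x,y}`-free ones).  Dossier §24: at the diagonal first layer
`p = q + 2`, `|E| = 2q + 3`, this reads `(q+1)·#{S ⊆ E′ : r(S) = q+1} ≥ (q+2)·(#U_N + C1 + C2)` on `N` of rank `q+2`
on `2q+2` elements; census-clean (q = 2: all 18 loopless rank-4 matroids on 6 elements, 260 pairs, min ratio 11/8;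
q = 3: all 217 simple rank-5 matroids on 8 elements, 6,076 pairs, min ratio 3/2; own exact code dpdiag.py).

* `lineFreeSet`, `lineFreeCount` — the `{x,y}`-free partitions of `E ∖ e` with ranks `(a, b)`;
* `partSet_free_subset_lineFreeSet`, **`freeCount_le_lineFreeCount`** — `e ∈ cl{x,y}` ⇒ `n⁰⁰_{ab}(e) ≤ lineFreeCount`;
* **`slack_contract_le_of_delete_pays_line`** — `e ∈ cl{x,y}`, rank `p + 1`, `e` a non-loop, and
  `Φ(p+1,q+1)·lineFreeCount M e x y p (q+1) ≤ σ_{M ＼ e}(p+1,q+1)` ⇒ (MC″) at `e`: `σ_{M ／ e}(p,q) ≤ σ_M(p+1,q+1)`.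
Axioms: standard.
-/

open scoped Matroid

namespace PercRepro

open Set

namespace Matroid

variable {α : Type} {M : _root_.Matroid α} {e x y : α}

/-- The partitions `(A, (E ∖ e) ∖ A)` of `E ∖ {e}` with ranks `(a, b)` in which the pair `{x, y}` lies in the
closure of NEITHER side. -/
def lineFreeSet (M : _root_.Matroid α) (e x y : α) (a b : ℕ) : Set (Set α) :=
  {A : Set α | A ⊆ M.E \ {e} ∧ M.eRk A = (a : ℕ∞) ∧ M.eRk ((M.E \ {e}) \ A) = (b : ℕ∞) ∧
    ¬ ({x, y} ⊆ M.closure A) ∧ ¬ ({x, y} ⊆ M.closure ((M.E \ {e}) \ A))}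

/-- The number of `{x,y}`-free partitions of `E ∖ {e}` with ranks `(a, b)`. -/
noncomputable def lineFreeCount (M : _root_.Matroid α) (e x y : α) (a b : ℕ) : ℕ :=
  (lineFreeSet M e x y a b).ncard

/-- If `e ∈ cl{x, y}` then every `e`-free partition is `{x,y}`-free. -/
lemma partSet_free_subset_lineFreeSet (he : e ∈ M.closure {x, y}) (a b : ℕ) :
    partSet M e a b False False ⊆ lineFreeSet M e x y a b := by
  intro A hA
  obtain ⟨hAE, ha, hb, hca, hcb⟩ := hA
  refine ⟨hAE, ha, hb, ?_, ?_⟩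
  · intro hxy
    exact hca.1 (M.closure_subset_closure_of_subset_closure hxy he)
  · intro hxy
    exact hcb.1 (M.closure_subset_closure_of_subset_closure hxy he)

variable [M.Finite]

/-- `lineFreeSet` is finite. -/
lemma lineFreeSet_finite (a b : ℕ) : (lineFreeSet M e x y a b).Finite :=
  (M.ground_finite.subset sdiff_subset).finite_subsets.subset (fun _ hA => hA.1)

/-- **The exposure at a point of a line is bounded by the `{x,y}`-free count**: `e ∈ cl{x, y}` ⇒
`n⁰⁰_{ab}(e) ≤ lineFreeCount M e x y a b`. -/
theorem freeCount_le_lineFreeCount (he : e ∈ M.closure {x, y}) (a b : ℕ) :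
    freeCount M e a b ≤ lineFreeCount M e x y a b :=
  Set.ncard_le_ncard (partSet_free_subset_lineFreeSet he a b) (lineFreeSet_finite a b)

/-- **DELETION PAYS THE LINE-FREE COUNT ⇒ (MC″)** at a point `e` of the line through `x, y`: if
`Φ(p+1,q+1)·lineFreeCount M e x y p (q+1) ≤ σ_{M ＼ e}(p+1,q+1)` (an inequality about `M ＼ e` and the pair `{x,y}`
alone) then `σ_{M ／ e}(p,q) ≤ σ_M(p+1,q+1)`. -/
theorem slack_contract_le_of_delete_pays_line (heI : M.Indep {e}) (hexy : e ∈ M.closure {x, y}) {p : ℕ}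
    (hR : M.eRank = ((p + 1 : ℕ) : ℕ∞)) (q : ℕ)
    (hpay : phiK (p + 1) (q + 1) * (lineFreeCount M e x y p (q + 1) : ℚ) ≤ slack (M ＼ {e}) (p + 1) (q + 1)) :
    slack (M ／ {e}) p q ≤ slack M (p + 1) (q + 1) := by
  refine slack_contract_le_of_delete_pays heI hR q (le_trans ?_ hpay)
  have hphi0 : 0 ≤ phiK (p + 1) (q + 1) := by unfold phiK; positivity
  have hle : (freeCount M e p (q + 1) : ℚ) ≤ (lineFreeCount M e x y p (q + 1) : ℚ) := by
    exact_mod_cast freeCount_le_lineFreeCount hexy p (q + 1)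
  exact mul_le_mul_of_nonneg_left hle hphi0

end Matroid

end PercRepro
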